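import Literature.Computability.AlgebraicComplexity.RelativeExponent
import Literature.Computability.AlgebraicComplexity.TensorRestrictionRank
import HarnessLib

/-!
# Monomial restriction calculus; CVZ Prop. 7 (`ω ≤ ω_M`, `i ≤ i_M`) proved

Topic `Literature/Computability/AlgebraicComplexity`; sibling of `RelativeExponent.lean`, which
defines monomial restriction `TensorMonRestrictsTo` (`t ≥_M s`), `monRestrictionCost`,
`monRelativeExponent` (`ω_M`) and `monIrreversibility` (`i_M`) after M. Christandl, P. Vrana,
J. Zuiddam, *Barriers for fast matrix multiplication from irreversibility*, Theory of Computing 17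
(2021), art. 2 = arXiv:1812.06952, §2.4 (**arXiv v1/v2 numbering**, Prop. 7 on p. 6; page-checked
with `lit read`). Everything in this file is PROVED, over a commutative semiring.

## Content

* Generalised sub-permutation matrices are closed under products (`IsGenSubperm.comp`) and under
  coordinatewise (Kronecker) products over a finite index type (`IsGenSubperm.pi`), and the `0/1`
  matrix of an injective index map is one (`isGenSubperm_of_injective`).
* Hence monomial restriction is a preorder compatible with tensor powers:
  `TensorMonRestrictsTo.trans`, `TensorMonRestrictsTo.kroneckerPow` (`t ≥_M s ⇒ t^{⊗N} ≥_M s^{⊗N}`),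
  `tensorMonRestrictsTo_precomp` (relabelling along INJECTIVE index maps is a monomial
  restriction), `tensorMonRestrictsTo_kroneckerPow_mul` (`t^{⊗(N n)} ≥_M (t^{⊗n})^{⊗N}`, along
  `finProdFinEquiv`), `tensorMonRestrictsTo_kroneckerPow_mul_of`
  (`t^{⊗m} ≥_M s ⇒ t^{⊗(N m)} ≥_M s^{⊗N}`).
* **CVZ Prop. 7**, third and fourth items, for the tree's infimum formalisation of relative
  exponents: `relativeExponent_le_monRelativeExponent` (`ω(t,s) ≤ ω_M(t,s)`) and
  `irreversibility_le_monIrreversibility` (`i(t) ≤ i_M(t)`), each under the finiteness hypothesis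
  `∃ m, t^{⊗m} ≥_M s` (resp. `s = ⟨2⟩`) which makes every set defining `ω_M(t,s)` nonempty (see
  "junk values" in the module docstring of `RelativeExponent.lean`; in print the excluded cases
  read `∞ ≥ ω(t,s)`). The named fact `CVZ2021_prop7` of the barrier catalogue
  (`Literature/Barriers/MatrixMultiplication/IrreversibilityBarrier.lean`) follows from the latter.

## Proof

CVZ print no proof ("replacing the preorder `≥` by `≥_M`", §2.4). A monomial restriction is a
restriction, so `min {m' | t^{⊗m'} ≥ s^{⊗n}} ≤ min {m' | t^{⊗m'} ≥_M s^{⊗n}}` as soon as the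
right-hand set is nonempty (`restrictionCost_le_monRestrictionCost`, `RelativeExponent.lean`); from
one witness `t^{⊗m} ≥_M s` and the calculus above, `t^{⊗(n m)} ≥_M (t^{⊗m})^{⊗n} ≥_M s^{⊗n}` for
every `n`, so the inequality holds termwise in the two infima, and multiplying by `ω(⟨2⟩,t) ≥ 0`
gives `i(t) ≤ i_M(t)`. The entry identities for composition and powers are those of
`TensorRestrictsTo.trans` (`TensorRestrictionRank.lean`) and `TensorRestrictsTo.kroneckerPi`
(`GroupAlgebraTensor.lean`); only the sub-permutation bookkeeping is new.

## References

* M. Christandl, P. Vrana, J. Zuiddam, ToC 17 (2021), art. 2 = arXiv:1812.06952, §2.4 and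
  Prop. 7 (p. 6). [ChristandlVranaZuiddam2021]
* V. Strassen, *Relative bilinear complexity and matrix multiplication*, J. reine angew. Math.
  375/376 (1987), 406–443 — monomial restriction (cited through CVZ §2.4).
-/

noncomputable section

open scoped BigOperators

namespace Literature.Computability.AlgebraicComplexity

universe u

/-! ## Generalised sub-permutation matrices: products, Kronecker products, injective maps -/

section GenSubperm

variable {K : Type u} [CommSemiring K]
variable {ι ι' ι'' : Type*}

/-- The product `A' A` of two generalised sub-permutation matrices is a generalised sub-permutation
matrix (no integrality assumption on `K`: a nonzero entry of the product has a nonzero summand,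
both of whose factors are nonzero). [folklore] -/
theorem IsGenSubperm.comp [Fintype ι'] {A' : ι'' → ι' → K} {A : ι' → ι → K}
    (hA' : IsGenSubperm A') (hA : IsGenSubperm A) :
    IsGenSubperm (fun a'' a => ∑ a', A' a'' a' * A a' a) := by
  refine ⟨fun a'' a₁ a₂ h₁ h₂ => ?_, fun a a''₁ a''₂ h₁ h₂ => ?_⟩
  · obtain ⟨a'₁, -, h₁⟩ := Finset.exists_ne_zero_of_sum_ne_zero h₁
    obtain ⟨a'₂, -, h₂⟩ := Finset.exists_ne_zero_of_sum_ne_zero h₂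
    have e : a'₁ = a'₂ := hA'.1 a'' a'₁ a'₂ (left_ne_zero_of_mul h₁) (left_ne_zero_of_mul h₂)
    subst e
    exact hA.1 a'₁ a₁ a₂ (right_ne_zero_of_mul h₁) (right_ne_zero_of_mul h₂)
  · obtain ⟨a'₁, -, h₁⟩ := Finset.exists_ne_zero_of_sum_ne_zero h₁
    obtain ⟨a'₂, -, h₂⟩ := Finset.exists_ne_zero_of_sum_ne_zero h₂
    have e : a'₁ = a'₂ := hA.2 a a'₁ a'₂ (right_ne_zero_of_mul h₁) (right_ne_zero_of_mul h₂)
    subst e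
    exact hA'.2 a'₁ a''₁ a''₂ (left_ne_zero_of_mul h₁) (left_ne_zero_of_mul h₂)

/-- A coordinatewise (Kronecker) product `⊗ₗ Aₗ` of generalised sub-permutation matrices, as a
matrix indexed by functions `L → ι'`, `L → ι`, is a generalised sub-permutation matrix (a nonzero
product has all factors nonzero). [folklore] -/
theorem IsGenSubperm.pi {L : Type*} [Fintype L] {A : L → ι' → ι → K}
    (hA : ∀ l, IsGenSubperm (A l)) :
    IsGenSubperm (fun (a' : L → ι') (a : L → ι) => ∏ l, A l (a' l) (a l)) := by
  refine ⟨fun a' a₁ a₂ h₁ h₂ => funext fun l => ?_, fun a a'₁ a'₂ h₁ h₂ => funext fun l => ?_⟩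
  · exact (hA l).1 (a' l) (a₁ l) (a₂ l)
      (fun h => h₁ (Finset.prod_eq_zero (Finset.mem_univ l) h))
      (fun h => h₂ (Finset.prod_eq_zero (Finset.mem_univ l) h))
  · exact (hA l).2 (a l) (a'₁ l) (a'₂ l)
      (fun h => h₁ (Finset.prod_eq_zero (Finset.mem_univ l) h))
      (fun h => h₂ (Finset.prod_eq_zero (Finset.mem_univ l) h))

/-- The `0/1` matrix `(a', a) ↦ [f a' = a]` of an INJECTIVE index map `f` is a generalised
sub-permutation matrix (one entry in each row; injectivity gives at most one in each column).
[folklore] -/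
theorem isGenSubperm_of_injective [DecidableEq ι] {f : ι' → ι} (hf : Function.Injective f) :
    IsGenSubperm (fun a' a => if f a' = a then (1 : K) else 0) := by
  refine ⟨fun a' a₁ a₂ h₁ h₂ => ?_, fun a a'₁ a'₂ h₁ h₂ => ?_⟩
  · have e₁ : f a' = a₁ := by by_contra h; exact h₁ (if_neg h)
    have e₂ : f a' = a₂ := by by_contra h; exact h₂ (if_neg h)
    exact e₁.symm.trans e₂
  · have e₁ : f a'₁ = a := by by_contra h; exact h₁ (if_neg h)
    have e₂ : f a'₂ = a := by by_contra h; exact h₂ (if_neg h)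
    exact hf (e₁.trans e₂.symm)

/-- Flattening `L → M → α` to `N → α` along a bijection `e : L × M ≃ N` is injective. [folklore] -/
theorem flatten_injective {α L M N : Type*} (e : L × M ≃ N) :
    Function.Injective fun (a : L → M → α) (x : N) => a (e.symm x).1 (e.symm x).2 := by
  intro a₁ a₂ h
  funext i j
  have := congrFun h (e (i, j))
  simpa using this

end GenSubperm

/-! ## Monomial restriction: transitivity, powers, injective relabelling -/

section MonRestriction

variable {K : Type u} [CommSemiring K]
variable {ι κ μ ι' κ' μ' ι'' κ'' μ'' : Type*} [Fintype ι] [Fintype κ] [Fintype μ]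

/-- **Monomial restriction is transitive**: `t ≥_M s`, `s ≥_M p` imply `t ≥_M p` (compose the
maps: the entry identity of `TensorRestrictsTo.trans`, the composed matrices being generalised
sub-permutation matrices by `IsGenSubperm.comp`). [cite: ChristandlVranaZuiddam2021, §2.4] -/
theorem TensorMonRestrictsTo.trans [Fintype ι'] [Fintype κ'] [Fintype μ']
    {t : ι → κ → μ → K} {s : ι' → κ' → μ' → K} {p : ι'' → κ'' → μ'' → K}
    (hts : TensorMonRestrictsTo t s) (hsp : TensorMonRestrictsTo s p) :
    TensorMonRestrictsTo t p := by
  obtain ⟨A, B, C, hA, hB, hC, hs⟩ := hts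
  obtain ⟨A', B', C', hA', hB', hC', hp⟩ := hsp
  refine ⟨fun a'' a => ∑ a', A' a'' a' * A a' a, fun b'' b => ∑ b', B' b'' b' * B b' b,
    fun c'' c => ∑ c', C' c'' c' * C c' c, hA'.comp hA, hB'.comp hB, hC'.comp hC,
    fun a'' b'' c'' => ?_⟩
  rw [hp]
  simp only [hs, Finset.mul_sum, Finset.sum_mul]
  -- LHS binders `a' b' c' a b c`, RHS binders `a b c c' b' a'`
  rw [sum_comm₃]
  refine Finset.sum_congr rfl fun a _ => Finset.sum_congr rfl fun b _ =>
    Finset.sum_congr rfl fun c _ => ?_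
  rw [sum_rev₃]
  refine Finset.sum_congr rfl fun c' _ => Finset.sum_congr rfl fun b' _ =>
    Finset.sum_congr rfl fun a' _ => ?_
  ring

/-- **Monomial restriction is compatible with tensor powers**: `t ≥_M s ⇒ t^{⊗N} ≥_M s^{⊗N}`,
the matrices being the Kronecker powers `A^{⊗N}, B^{⊗N}, C^{⊗N}` (entry identity as in
`TensorRestrictsTo.kroneckerPi`). [cite: ChristandlVranaZuiddam2021, §2.4] -/
theorem TensorMonRestrictsTo.kroneckerPow {t : ι → κ → μ → K} {s : ι' → κ' → μ' → K}
    (h : TensorMonRestrictsTo t s) (N : ℕ) :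
    TensorMonRestrictsTo (kroneckerPow t N) (kroneckerPow s N) := by
  classical
  obtain ⟨A, B, C, hA, hB, hC, hs⟩ := h
  refine ⟨fun a' a => ∏ l, A (a' l) (a l), fun b' b => ∏ l, B (b' l) (b l),
    fun c' c => ∏ l, C (c' l) (c l), IsGenSubperm.pi fun _ => hA, IsGenSubperm.pi fun _ => hB,
    IsGenSubperm.pi fun _ => hC, fun a' b' c' => ?_⟩
  simp only [kroneckerPow_apply]
  simp_rw [hs]
  rw [Fintype.prod_sum]
  refine Finset.sum_congr rfl fun a _ => ?_
  rw [Fintype.prod_sum]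
  refine Finset.sum_congr rfl fun b _ => ?_
  rw [Fintype.prod_sum]
  refine Finset.sum_congr rfl fun c _ => ?_
  rw [Finset.prod_mul_distrib, Finset.prod_mul_distrib, Finset.prod_mul_distrib]

/-- **Relabelling along injective index maps is a monomial restriction**:
`t ≥_M t ∘ (f × g × h)` for injective `f, g, h` (the `0/1` matrices of `tensorRestrictsTo_precomp`
are then generalised sub-permutation matrices). [cite: ChristandlVranaZuiddam2021, §2.4] -/
theorem tensorMonRestrictsTo_precomp (t : ι → κ → μ → K) {f : ι' → ι} {g : κ' → κ} {h : μ' → μ}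
    (hf : Function.Injective f) (hg : Function.Injective g) (hh : Function.Injective h) :
    TensorMonRestrictsTo t (fun a b c => t (f a) (g b) (h c)) := by
  classical
  refine ⟨fun a' a => if f a' = a then 1 else 0, fun b' b => if g b' = b then 1 else 0,
    fun c' c => if h c' = c then 1 else 0, isGenSubperm_of_injective hf,
    isGenSubperm_of_injective hg, isGenSubperm_of_injective hh, fun a' b' c' => ?_⟩
  rw [Finset.sum_eq_single (f a') (fun a _ ha => by simp [Ne.symm ha]) (by simp),
    Finset.sum_eq_single (g b') (fun b _ hb => by simp [Ne.symm hb]) (by simp),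
    Finset.sum_eq_single (h c') (fun c _ hc => by simp [Ne.symm hc]) (by simp)]
  simp

/-- **Power of a power, monomially**: `t^{⊗(N n)} ≥_M (t^{⊗n})^{⊗N}` — the relabelling of
`tensorRestrictsTo_kroneckerPow_mul` (`UniversalMethodBarrierProducts.lean`) along
`finProdFinEquiv : Fin N × Fin n ≃ Fin (N n)` is injective. [folklore] -/
theorem tensorMonRestrictsTo_kroneckerPow_mul (t : ι → κ → μ → K) (N n : ℕ) :
    TensorMonRestrictsTo (kroneckerPow t (N * n)) (kroneckerPow (kroneckerPow t n) N) := by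
  have key : kroneckerPow (kroneckerPow t n) N = fun a b c =>
      kroneckerPow t (N * n) (fun x => a (finProdFinEquiv.symm x).1 (finProdFinEquiv.symm x).2)
        (fun x => b (finProdFinEquiv.symm x).1 (finProdFinEquiv.symm x).2)
        (fun x => c (finProdFinEquiv.symm x).1 (finProdFinEquiv.symm x).2) := by
    funext a b c
    simp only [kroneckerPow_apply]
    rw [← Fintype.prod_prod_type' (f := fun i j => t (a i j) (b i j) (c i j))]
    exact (Fintype.prod_equiv finProdFinEquiv.symm _ _ fun x => rfl).symm
  rw [key]
  exact tensorMonRestrictsTo_precomp _ (flatten_injective _) (flatten_injective _)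
    (flatten_injective _)

/-- From ONE monomial witness to all powers: `t^{⊗m} ≥_M s ⇒ t^{⊗(N m)} ≥_M s^{⊗N}`
(`t^{⊗(N m)} ≥_M (t^{⊗m})^{⊗N} ≥_M s^{⊗N}`; monomial restrictions "multiply" under `⊗`).
[cite: ChristandlVranaZuiddam2021, §2.4] -/
theorem tensorMonRestrictsTo_kroneckerPow_mul_of {t : ι → κ → μ → K} {s : ι' → κ' → μ' → K}
    {m : ℕ} (h : TensorMonRestrictsTo (kroneckerPow t m) s) (N : ℕ) :
    TensorMonRestrictsTo (kroneckerPow t (N * m)) (kroneckerPow s N) := by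
  classical
  exact (tensorMonRestrictsTo_kroneckerPow_mul t N m).trans (h.kroneckerPow N)

end MonRestriction

/-! ## CVZ Prop. 7: `ω(t,s) ≤ ω_M(t,s)` and `i(t) ≤ i_M(t)` -/

section Prop7

variable {K : Type u} [CommSemiring K]
variable {ι κ μ ι' κ' μ' : Type*} [Fintype ι] [Fintype κ] [Fintype μ]

/-- Under one monomial witness `t^{⊗m} ≥_M s` every set `{m' | t^{⊗m'} ≥_M s^{⊗n}}` is nonempty,
so `min {m' | t^{⊗m'} ≥ s^{⊗n}} ≤ min {m' | t^{⊗m'} ≥_M s^{⊗n}}` for EVERY `n` (pointwise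
`ω ≤ ω_M`, CVZ Prop. 7). [cite: ChristandlVranaZuiddam2021, Prop. 7] -/
theorem restrictionCost_le_monRestrictionCost_of_witness {t : ι → κ → μ → K}
    {s : ι' → κ' → μ' → K} (h : ∃ m, TensorMonRestrictsTo (kroneckerPow t m) s) (n : ℕ) :
    restrictionCost t s n ≤ monRestrictionCost t s n := by
  obtain ⟨m, hm⟩ := h
  exact restrictionCost_le_monRestrictionCost ⟨n * m, tensorMonRestrictsTo_kroneckerPow_mul_of hm n⟩

/-- **CVZ 2021, Prop. 7 (third item)**: `ω_M(t, s) ≥ ω(t, s)` (a monomial restriction is a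
restriction), for the tree's infimum formalisation of both relative exponents, under the
finiteness hypothesis `∃ m, t^{⊗m} ≥_M s` (`ω_M(t,s) < ∞`; without it the printed `ω_M(t,s)` is
`+∞`, vacuously `≥ ω(t,s)`, while the Lean value is the junk `0`).
[cite: ChristandlVranaZuiddam2021, Prop. 7] -/
theorem relativeExponent_le_monRelativeExponent {t : ι → κ → μ → K} {s : ι' → κ' → μ' → K}
    (h : ∃ m, TensorMonRestrictsTo (kroneckerPow t m) s) :
    relativeExponent t s ≤ monRelativeExponent t s := by
  refine ciInf_mono (relativeExponent_bddBelow t s) fun n => ?_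
  have hpos : (0 : ℝ) < (n : ℝ) + 1 := by positivity
  exact div_le_div_of_nonneg_right
    (by exact_mod_cast restrictionCost_le_monRestrictionCost_of_witness h (n + 1)) hpos.le

/-- **CVZ 2021, Prop. 7 (fourth item)**: `i_M(t) ≥ i(t)`, i.e.
`ω(⟨2⟩,t) · ω(t,⟨2⟩) ≤ ω(⟨2⟩,t) · ω_M(t,⟨2⟩)` (`ω(⟨2⟩,t) ≥ 0` times the third item at `s = ⟨2⟩`),
under the finiteness hypothesis `∃ m, t^{⊗m} ≥_M ⟨2⟩` (`Q̃_M(t) > 1`).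
[cite: ChristandlVranaZuiddam2021, Prop. 7] -/
theorem irreversibility_le_monIrreversibility {t : ι → κ → μ → K}
    (h : ∃ m, TensorMonRestrictsTo (kroneckerPow t m) (unitTensor K 2)) :
    irreversibility t ≤ monIrreversibility t :=
  mul_le_mul_of_nonneg_left (relativeExponent_le_monRelativeExponent h)
    (relativeExponent_nonneg _ _)

end Prop7

end Literature.Computability.AlgebraicComplexity

end
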